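import Literature.AlgebraicGeometry.HodgeTheory.BettiHardLefschetzHodgeMorphisms
import Literature.AlgebraicGeometry.HodgeTheory.BettiHodgeConjectureProductNoExceptionalClasses
import Literature.AlgebraicGeometry.HodgeTheory.BettiEulerCharacteristicProducts
import HarnessLib

/-!
# The Hodge conjecture for products with three factors: `(S × S') × C`, `(S × S') × T`, `(S × S') × S''`, `(T × T') × C`, `(S × T) × C` — the two-factor criteria of g28-#1 (merged by hard
# Lefschetz) feeding the "no odd cohomology × pure even cohomology" transfer of g27-#5 (Voisin I §11.3.3 Thm. 11.38, Lemma 11.41, p. 287; Künneth for the Betti numbers)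

Family `hodge`, lane `lit-hodgefound` (Track 2 foundations library; Layers A1/A4), layer `Literature/AlgebraicGeometry/HodgeTheory`.  THEOREMS ONLY (no definition,
no named fact, no instance; D-0026 net debt `0`).  Sequel of the seat's g27-#9 / g27-#11 (`HC(S ⊗ S')`, `HC(S ⊗ T)` for `q(S) = 0` and `dim Hom_HS(H²S, H²·) ≤ ρρ'`), g28-#1
(`BettiHardLefschetzHodgeMorphisms`: `HC(T ⊗ T')` for `q = 0` ⟸ `Hom_HS(H³T, H³T') = 0` ∧ `dim Hom_HS(H²T, H²T') ≤ ρρ'`) and of g27-#5 (`BettiHodgeConjectureProductNoExceptionalClasses`: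
`HC(Y) ∧ HC(Z) ⟹ HC(Y ⊗ Z)` when `Y` has no odd cohomology and `Z` has even cohomology of pure type; `HC(Y) ⟹ HC(Y ⊗ C)` for `Y` without odd cohomology and ANY curve `C`).  A product
`S ⊗ S'` of surfaces with `q = 0` has no odd cohomology (Künneth for the rational Betti numbers, gen-25's `finrank_bettiCohomology_tensor`), so once `HC(S ⊗ S')` is secured (g27-#9) the
transfer applies to a third factor: any curve, any threefold with `h^{2,0} = 0`, any surface with `p_g = 0`, any `Z` with pure even cohomology for which `HC(Z)` is known — e.g. **`HC` FOR THE
FIVEFOLD `K3 × K3' × C`** whenever the two K3 surfaces admit no exceptional morphism `H²(S) → H²(S')`.  Likewise `(T ⊗ T') ⊗ C` for threefolds with `b₁ = b₃ = 0` and `(S ⊗ T) ⊗ C`.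

THE PRINTS.  C. Voisin (2002) [VoisinHodgeI2002] §11.3.3 Thm. 11.38 (p. 285), Lemma 11.41 (p. 286), p. 287; Thm. 11.30; §6.2.3 Thm. 6.25; §7.1.2.  A. Hatcher (2002) [HatcherAT2002] §3.2 Thm. 3.16
(Künneth).  D. Arapura, *Motivation for Hodge cycles* (2006) [Arapura2001HodgeCyclesModuli] Lemma 9, Cor. 10 (products with a factor whose cohomology is spanned by algebraic classes).
P. Deligne (2000) [Deligne2000] §1.

THE OBJECTS (all the tree's).  `Hᵏ(X) = BettiUniverse.hodge hHD hX k`, `b_k(X) = dim_ℚ (bettiCohomology X k)`, `ρ(X) = dim_ℚ Hdg¹(H²(X))`, `q(X) = h^{1,0}`, `p_g(S) = h^{2,0}`; `HodgeStructure.Hom`;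
`HodgeConjectureFor d W`; products `Y ⊗ Z` in `SchemeOver ℂ` with ANY smooth-projective structure of the stated dimension (the triple products are parenthesised `(Y ⊗ Z) ⊗ W`);
`[HodgeTensorFacts.{0, 0}]`.

WHAT IS PROVED.
* §1 BETTI NUMBERS: **a product of two varieties without odd cohomology has no odd cohomology** (`BettiUniverse.finrank_bettiCohomology_tensor_eq_zero_of_odd`; Künneth); surfaces with `q = 0`
  (`…_surfaces_of_q_zero`), threefolds with `b₁ = b₃ = 0` (`finrank_bettiCohomology_odd_eq_zero_threefold`), surface × such a threefold.
* §2 THREE FACTORS (two-factor inputs: g27-#9 `hodgeConjectureFor_tensor_surfaces_of_q_zero_of_finrank_hom_le`, g27-#11 `hodgeConjectureFor_surface_tensor_threefold_of_q_zero_of_finrank_hom_le`,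
  g28-#1 `hodgeConjectureFor_tensor_threefolds_of_q_zero_of_hom_of_hardLefschetz`): for surfaces `S`, `S'` with `q(S) = q(S') = 0` and `dim Hom_HS(H²S, H²S') ≤ ρρ'`: **`HC((S ⊗ S') ⊗ C)`** for every curve `C` (`BettiUniverse.hodgeConjectureFor_surfaces_tensor_curve`),
  **`HC((S ⊗ S') ⊗ T)`** for every threefold with `h^{2,0}(T) = 0` (`…_surfaces_tensor_threefold_of_h20_zero`), **`HC((S ⊗ S') ⊗ S'')`** for every surface with `p_g(S'') = 0`
  (`…_surfaces_tensor_surface_of_pg_zero`), and `HC((S ⊗ S') ⊗ Z)` for every `Z` with even cohomology of pure type satisfying `HC` (`…_surfaces_tensor_of_pure_even`); for threefolds `T`, `T'`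
  with `q = 0`, `b₃ = 0` and `dim Hom_HS(H²T, H²T') ≤ ρρ'`: **`HC((T ⊗ T') ⊗ C)`** (`BettiUniverse.hodgeConjectureFor_threefolds_tensor_curve`); for a surface `S` with `q(S) = 0` and a threefold `T`
  with `q(T) = 0`, `b₃(T) = 0` (odd-freeness of `S ⊗ T`), `dim Hom_HS(H²S, H²T) ≤ ρρ'`: **`HC((S ⊗ T) ⊗ C)`** (`BettiUniverse.hodgeConjectureFor_surface_threefold_tensor_curve`).

DEVIATIONS / SCOPE.  `HC(S ⊗ (S' ⊗ C))` (the other bracketing) is not restated (no transport of `HodgeConjectureFor` along the associator in the tree's vocabulary is used here); three K3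
surfaces `S ⊗ S' ⊗ S''` with `p_g(S'') ≠ 0` are out of reach of the "no exceptional classes" method (g28-#2/#3).

## References
* [VoisinHodgeI2002] C. Voisin, *Hodge Theory and Complex Algebraic Geometry I* (2002) — §11.3.3 Thm. 11.38 (p. 285), Lemma 11.41 (p. 286), p. 287; Thm. 11.30; §6.2.3 Thm. 6.25; §7.1.2.
* [HatcherAT2002] A. Hatcher, *Algebraic Topology* (2002) — §3.2 Thm. 3.16.
* [Arapura2001HodgeCyclesModuli] D. Arapura, *Motivation for Hodge cycles*, Adv. Math. 207 (2006) — Lemma 9, Cor. 10.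
* [Deligne2000] P. Deligne, *The Hodge conjecture* (Clay, 2000) — §1.

## Provenance
Lane `lit-hodgefound` (Hodge path, Track 2), prover seat `lit-hodgefound-p29` (generation 28), self-proposed row g28-#4 (gen-27 HANDOFF free pointer (c); sequel of g28-#1 and g27-#5).
-/

noncomputable section

open scoped TensorProduct
open CategoryTheory MonoidalCategory Module Finset
open Literature.AlgebraicTopology.SingularHomology
open Literature.Geometry.Kaehler

namespace Literature.AlgebraicGeometry.HodgeTheory

open Literature.AlgebraicGeometry.Motives
open Literature.AlgebraicGeometry.Motives.HodgeStructure

variable {m n d d' : ℕ} {Y Z S S' S'' T T' C : SchemeOver ℂ}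

/-! ### §1 Odd Betti numbers of products -/

/-- **A product of two smooth projective varieties without odd (rational) cohomology has no odd cohomology**: `b_k(Y ⊗ Z) = Σ_{j ≤ k} b_{k−j}(Y) b_j(Z)` (Künneth) and one of `k − j`, `j` is odd
when `k` is. [cite: HatcherAT2002, §3.2 Thm. 3.16] -/
theorem BettiUniverse.finrank_bettiCohomology_tensor_eq_zero_of_odd (hY : IsSmoothProjective m Y) (hZ : IsSmoothProjective n Z)
    (hoddY : ∀ k : ℕ, Odd k → Module.finrank ℚ (bettiCohomology Y k) = 0) (hoddZ : ∀ k : ℕ, Odd k → Module.finrank ℚ (bettiCohomology Z k) = 0) {k : ℕ} (hk : Odd k) :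
    Module.finrank ℚ (bettiCohomology (Y ⊗ Z) k) = 0 := by
  rw [BettiUniverse.finrank_bettiCohomology_tensor hY hZ k]
  refine Finset.sum_eq_zero fun j hj ↦ ?_
  rw [Finset.mem_range] at hj
  rcases Nat.even_or_odd j with hje | hjo
  · have hkj : Odd (k - j) := by
      obtain ⟨a, rfl⟩ := hk
      obtain ⟨b, rfl⟩ := hje
      exact ⟨a - b, by omega⟩
    rw [hoddY (k - j) hkj, zero_mul]
  · rw [hoddZ j hjo, mul_zero]

/-- **`S ⊗ S'` has no odd cohomology for surfaces with `q(S) = q(S') = 0`** (`b₁ = b₃ = 0` on both factors). [cite: HatcherAT2002, §3.2 Thm. 3.16] [cite: VoisinHodgeI2002, §6.1.3 Cor. 6.13 and §6.2.3 Thm. 6.25] -/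
theorem BettiUniverse.finrank_bettiCohomology_tensor_surfaces_eq_zero_of_q_zero (hHD : exists_isReal_hodgeModel) (hS : IsSmoothProjective 2 S) (hS' : IsSmoothProjective 2 S')
    (hq : (BettiUniverse.hodge hHD hS 1).hodgeNumber 1 0 = 0) (hq' : (BettiUniverse.hodge hHD hS' 1).hodgeNumber 1 0 = 0) {k : ℕ} (hk : Odd k) :
    Module.finrank ℚ (bettiCohomology (S ⊗ S') k) = 0 :=
  BettiUniverse.finrank_bettiCohomology_tensor_eq_zero_of_odd hS hS' (fun _ hj ↦ BettiUniverse.finrank_bettiCohomology_odd_eq_zero_surface_of_q_zero hHD hS hq hj)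
    (fun _ hj ↦ BettiUniverse.finrank_bettiCohomology_odd_eq_zero_surface_of_q_zero hHD hS' hq' hj) hk

/-- **A threefold with `q(T) = 0` and `b₃(T) = 0` has no odd cohomology** (`b₅ = b₁ = 2q = 0` by Poincaré duality). [cite: VoisinHodgeI2002, §6.1.3 Cor. 6.13 and §5.3.2 Thm. 5.30] -/
theorem BettiUniverse.finrank_bettiCohomology_odd_eq_zero_threefold (hHD : exists_isReal_hodgeModel) (hT : IsSmoothProjective 3 T) (hq : (BettiUniverse.hodge hHD hT 1).hodgeNumber 1 0 = 0)
    (hb3 : Module.finrank ℚ (bettiCohomology T 3) = 0) {k : ℕ} (hk : Odd k) : Module.finrank ℚ (bettiCohomology T k) = 0 := by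
  have h1 : Module.finrank ℚ (bettiCohomology T 1) = 0 := (BettiUniverse.finrank_bettiCohomology_one_eq_zero_iff hHD hT).2 hq
  obtain ⟨j, rfl⟩ := hk
  rcases Nat.lt_or_ge j 3 with hj | hj
  · rcases (by omega : j = 0 ∨ j = 1 ∨ j = 2) with rfl | rfl | rfl
    · exact h1
    · exact hb3
    · rw [BettiUniverse.finrank_bettiCohomology_eq_of_add_eq hT (k := 2 * 2 + 1) (l := 1) (by norm_num)]
      exact h1
  · exact BettiUniverse.finrank_bettiCohomology_eq_zero_of_lt hT (by omega)

/-- `T ⊗ T'` has no odd cohomology for threefolds with `q = 0` and `b₃ = 0`. [cite: HatcherAT2002, §3.2 Thm. 3.16] -/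
theorem BettiUniverse.finrank_bettiCohomology_tensor_threefolds_eq_zero_of_odd (hHD : exists_isReal_hodgeModel) (hT : IsSmoothProjective 3 T) (hT' : IsSmoothProjective 3 T')
    (hq : (BettiUniverse.hodge hHD hT 1).hodgeNumber 1 0 = 0) (hb3 : Module.finrank ℚ (bettiCohomology T 3) = 0) (hq' : (BettiUniverse.hodge hHD hT' 1).hodgeNumber 1 0 = 0)
    (hb3' : Module.finrank ℚ (bettiCohomology T' 3) = 0) {k : ℕ} (hk : Odd k) : Module.finrank ℚ (bettiCohomology (T ⊗ T') k) = 0 :=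
  BettiUniverse.finrank_bettiCohomology_tensor_eq_zero_of_odd hT hT' (fun _ hj ↦ BettiUniverse.finrank_bettiCohomology_odd_eq_zero_threefold hHD hT hq hb3 hj)
    (fun _ hj ↦ BettiUniverse.finrank_bettiCohomology_odd_eq_zero_threefold hHD hT' hq' hb3' hj) hk

/-- `S ⊗ T` has no odd cohomology for a surface with `q(S) = 0` and a threefold with `q(T) = 0`, `b₃(T) = 0`. [cite: HatcherAT2002, §3.2 Thm. 3.16] -/
theorem BettiUniverse.finrank_bettiCohomology_tensor_surface_threefold_eq_zero_of_odd (hHD : exists_isReal_hodgeModel) (hS : IsSmoothProjective 2 S) (hT : IsSmoothProjective 3 T)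
    (hqS : (BettiUniverse.hodge hHD hS 1).hodgeNumber 1 0 = 0) (hq : (BettiUniverse.hodge hHD hT 1).hodgeNumber 1 0 = 0) (hb3 : Module.finrank ℚ (bettiCohomology T 3) = 0) {k : ℕ}
    (hk : Odd k) : Module.finrank ℚ (bettiCohomology (S ⊗ T) k) = 0 :=
  BettiUniverse.finrank_bettiCohomology_tensor_eq_zero_of_odd hS hT (fun _ hj ↦ BettiUniverse.finrank_bettiCohomology_odd_eq_zero_surface_of_q_zero hHD hS hqS hj)
    (fun _ hj ↦ BettiUniverse.finrank_bettiCohomology_odd_eq_zero_threefold hHD hT hq hb3 hj) hk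

section HC

variable [HodgeTensorFacts.{0, 0}]

/-! ### §2 Three factors -/

/-- **`HC((S ⊗ S') ⊗ Z)` for surfaces with `q(S) = q(S') = 0`, `dim Hom_HS(H²S, H²S') ≤ ρρ'`, and any `Z` with even cohomology of pure type satisfying `HC(Z)`** (`S ⊗ S'` has no odd
cohomology and satisfies `HC`; g27-#5's transfer). [cite: VoisinHodgeI2002, §11.3.3 Thm. 11.38, Lemma 11.41 and p. 287] [cite: Arapura2001HodgeCyclesModuli, Lemma 9 and Cor. 10] [cite: Deligne2000, §1] -/
theorem BettiUniverse.hodgeConjectureFor_surfaces_tensor_of_pure_even (hHD : exists_isReal_hodgeModel) (hS : IsSmoothProjective 2 S) (hS' : IsSmoothProjective 2 S')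
    (hSS' : IsSmoothProjective 4 (S ⊗ S')) (hZ : IsSmoothProjective n Z) (hSSZ : IsSmoothProjective d ((S ⊗ S') ⊗ Z)) (hq : (BettiUniverse.hodge hHD hS 1).hodgeNumber 1 0 = 0)
    (hq' : (BettiUniverse.hodge hHD hS' 1).hodgeNumber 1 0 = 0)
    (h22 : Module.finrank ℚ (HodgeStructure.Hom (BettiUniverse.hodge hHD hS 2) (BettiUniverse.hodge hHD hS' 2)) ≤
      Module.finrank ℚ ↥((BettiUniverse.hodge hHD hS 2).hodgeClasses 1) * Module.finrank ℚ ↥((BettiUniverse.hodge hHD hS' 2).hodgeClasses 1))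
    (hevZ : ∀ b : ℕ, (BettiUniverse.hodge hHD hZ (2 * b)).hodgeClasses b = ⊤) (hHZ : HodgeConjectureFor n Z) : HodgeConjectureFor d ((S ⊗ S') ⊗ Z) :=
  BettiUniverse.hodgeConjectureFor_tensor_of_odd_vanishing_of_pure_even hHD hSS' hZ hSSZ (fun _ hk ↦ BettiUniverse.finrank_bettiCohomology_tensor_surfaces_eq_zero_of_q_zero hHD hS hS' hq hq' hk)
    hevZ (BettiUniverse.hodgeConjectureFor_tensor_surfaces_of_q_zero_of_finrank_hom_le hHD hS hS' hSS' hq h22) hHZ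

/-- **`HC((S ⊗ S') ⊗ C)` for surfaces with `q(S) = q(S') = 0`, `dim Hom_HS(H²S, H²S') ≤ ρρ'`, and EVERY curve `C`** — e.g. two K3 surfaces without exceptional morphisms `H²(S) → H²(S')` times any
curve, a fivefold. [cite: VoisinHodgeI2002, §11.3.3 Thm. 11.38, Lemma 11.41 and p. 287] [cite: Arapura2001HodgeCyclesModuli, Lemma 9] [cite: Deligne2000, §1] -/
theorem BettiUniverse.hodgeConjectureFor_surfaces_tensor_curve (hHD : exists_isReal_hodgeModel) (hS : IsSmoothProjective 2 S) (hS' : IsSmoothProjective 2 S') (hSS' : IsSmoothProjective 4 (S ⊗ S'))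
    (hC : IsSmoothProjective 1 C) (hSSC : IsSmoothProjective d ((S ⊗ S') ⊗ C)) (hq : (BettiUniverse.hodge hHD hS 1).hodgeNumber 1 0 = 0) (hq' : (BettiUniverse.hodge hHD hS' 1).hodgeNumber 1 0 = 0)
    (h22 : Module.finrank ℚ (HodgeStructure.Hom (BettiUniverse.hodge hHD hS 2) (BettiUniverse.hodge hHD hS' 2)) ≤
      Module.finrank ℚ ↥((BettiUniverse.hodge hHD hS 2).hodgeClasses 1) * Module.finrank ℚ ↥((BettiUniverse.hodge hHD hS' 2).hodgeClasses 1)) :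
    HodgeConjectureFor d ((S ⊗ S') ⊗ C) :=
  BettiUniverse.hodgeConjectureFor_tensor_curve_of_odd_vanishing hHD hSS' hC hSSC (fun _ hk ↦ BettiUniverse.finrank_bettiCohomology_tensor_surfaces_eq_zero_of_q_zero hHD hS hS' hq hq' hk)
    (BettiUniverse.hodgeConjectureFor_tensor_surfaces_of_q_zero_of_finrank_hom_le hHD hS hS' hSS' hq h22)

/-- **`HC((S ⊗ S') ⊗ T)` for surfaces with `q(S) = q(S') = 0`, `dim Hom_HS(H²S, H²S') ≤ ρρ'`, and every threefold `T` with `h^{2,0}(T) = 0`** (Fano or Calabi–Yau threefolds; a sevenfold).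
[cite: VoisinHodgeI2002, §11.3.3 Thm. 11.38, Lemma 11.41, p. 287 and Thm. 11.30] [cite: Arapura2001HodgeCyclesModuli, Lemma 9 and Cor. 10] [cite: Deligne2000, §1] -/
theorem BettiUniverse.hodgeConjectureFor_surfaces_tensor_threefold_of_h20_zero (hHD : exists_isReal_hodgeModel) (hS : IsSmoothProjective 2 S) (hS' : IsSmoothProjective 2 S')
    (hSS' : IsSmoothProjective 4 (S ⊗ S')) (hT : IsSmoothProjective 3 T) (hSST : IsSmoothProjective d ((S ⊗ S') ⊗ T)) (hq : (BettiUniverse.hodge hHD hS 1).hodgeNumber 1 0 = 0)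
    (hq' : (BettiUniverse.hodge hHD hS' 1).hodgeNumber 1 0 = 0)
    (h22 : Module.finrank ℚ (HodgeStructure.Hom (BettiUniverse.hodge hHD hS 2) (BettiUniverse.hodge hHD hS' 2)) ≤
      Module.finrank ℚ ↥((BettiUniverse.hodge hHD hS 2).hodgeClasses 1) * Module.finrank ℚ ↥((BettiUniverse.hodge hHD hS' 2).hodgeClasses 1))
    (h20 : (BettiUniverse.hodge hHD hT 2).hodgeNumber 2 0 = 0) : HodgeConjectureFor d ((S ⊗ S') ⊗ T) :=
  BettiUniverse.hodgeConjectureFor_surfaces_tensor_of_pure_even hHD hS hS' hSS' hT hSST hq hq' h22 (BettiUniverse.hodgeClasses_hodge_eq_top_threefold_of_h20_zero hHD hT h20)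
    (hodgeConjectureFor_of_dim_le_three_holds le_rfl hT)

/-- **`HC((S ⊗ S') ⊗ S'')` for surfaces with `q(S) = q(S') = 0`, `dim Hom_HS(H²S, H²S') ≤ ρρ'`, and every surface `S''` with `p_g(S'') = 0`** (a sixfold).
[cite: VoisinHodgeI2002, §11.3.3 Thm. 11.38, Lemma 11.41, p. 287 and Thm. 11.30] [cite: Arapura2001HodgeCyclesModuli, Lemma 9 and Cor. 10] [cite: Deligne2000, §1] -/
theorem BettiUniverse.hodgeConjectureFor_surfaces_tensor_surface_of_pg_zero (hHD : exists_isReal_hodgeModel) (hS : IsSmoothProjective 2 S) (hS' : IsSmoothProjective 2 S')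
    (hSS' : IsSmoothProjective 4 (S ⊗ S')) (hS'' : IsSmoothProjective 2 S'') (hSSS : IsSmoothProjective d ((S ⊗ S') ⊗ S'')) (hq : (BettiUniverse.hodge hHD hS 1).hodgeNumber 1 0 = 0)
    (hq' : (BettiUniverse.hodge hHD hS' 1).hodgeNumber 1 0 = 0)
    (h22 : Module.finrank ℚ (HodgeStructure.Hom (BettiUniverse.hodge hHD hS 2) (BettiUniverse.hodge hHD hS' 2)) ≤
      Module.finrank ℚ ↥((BettiUniverse.hodge hHD hS 2).hodgeClasses 1) * Module.finrank ℚ ↥((BettiUniverse.hodge hHD hS' 2).hodgeClasses 1))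
    (hpg : (BettiUniverse.hodge hHD hS'' 2).hodgeNumber 2 0 = 0) : HodgeConjectureFor d ((S ⊗ S') ⊗ S'') :=
  BettiUniverse.hodgeConjectureFor_surfaces_tensor_of_pure_even hHD hS hS' hSS' hS'' hSSS hq hq' h22 (BettiUniverse.hodgeClasses_hodge_eq_top_surface_of_pg_zero hHD hS'' hpg)
    (hodgeConjectureFor_of_dim_le_three_holds (by norm_num) hS'')

/-- **`HC((T ⊗ T') ⊗ C)` for threefolds with `q = 0`, `b₃ = 0`, `dim Hom_HS(H²T, H²T') ≤ ρ(T)ρ(T')`, and EVERY curve `C`** (`T ⊗ T'` has no odd cohomology, and satisfies `HC` by g28-#1's `q = 0`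
criterion, `Hom_HS(H³T, H³T') = 0` being automatic). [cite: VoisinHodgeI2002, §11.3.3 Thm. 11.38, Lemma 11.41, p. 287 and §6.2.3 Thm. 6.25] [cite: Arapura2001HodgeCyclesModuli, Lemma 9] [cite: Deligne2000, §1] -/
theorem BettiUniverse.hodgeConjectureFor_threefolds_tensor_curve (hHD : exists_isReal_hodgeModel) (hT : IsSmoothProjective 3 T) (hT' : IsSmoothProjective 3 T')
    (hTT' : IsSmoothProjective 6 (T ⊗ T')) (hC : IsSmoothProjective 1 C) (hTTC : IsSmoothProjective d ((T ⊗ T') ⊗ C)) (hq : (BettiUniverse.hodge hHD hT 1).hodgeNumber 1 0 = 0)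
    (hb3 : Module.finrank ℚ (bettiCohomology T 3) = 0) (hq' : (BettiUniverse.hodge hHD hT' 1).hodgeNumber 1 0 = 0) (hb3' : Module.finrank ℚ (bettiCohomology T' 3) = 0)
    (h22 : Module.finrank ℚ (HodgeStructure.Hom (BettiUniverse.hodge hHD hT 2) (BettiUniverse.hodge hHD hT' 2)) ≤
      Module.finrank ℚ ↥((BettiUniverse.hodge hHD hT 2).hodgeClasses 1) * Module.finrank ℚ ↥((BettiUniverse.hodge hHD hT' 2).hodgeClasses 1)) :
    HodgeConjectureFor d ((T ⊗ T') ⊗ C) := by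
  haveI := BettiUniverse.finite hT 3
  haveI : Subsingleton (bettiCohomology T 3) := Module.finrank_zero_iff.1 hb3
  exact BettiUniverse.hodgeConjectureFor_tensor_curve_of_odd_vanishing hHD hTT' hC hTTC
    (fun _ hk ↦ BettiUniverse.finrank_bettiCohomology_tensor_threefolds_eq_zero_of_odd hHD hT hT' hq hb3 hq' hb3' hk)
    (BettiUniverse.hodgeConjectureFor_tensor_threefolds_of_q_zero_of_hom_of_hardLefschetz hHD hT hT' hTT' hq hq' HodgeStructure.Hom.toLinearMap_injective.subsingleton h22)

/-- **`HC((S ⊗ T) ⊗ C)` for a surface `S` with `q(S) = 0`, a threefold `T` with `q(T) = 0`, `b₃(T) = 0`, `dim Hom_HS(H²S, H²T) ≤ ρ(S)ρ(T)`, and EVERY curve `C`** (g27-#11's `S × T` criterion for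
`q(S) = 0`, then the transfer). [cite: VoisinHodgeI2002, §11.3.3 Thm. 11.38, Lemma 11.41, p. 287 and §6.2.3 Thm. 6.25] [cite: Arapura2001HodgeCyclesModuli, Lemma 9] [cite: Deligne2000, §1] -/
theorem BettiUniverse.hodgeConjectureFor_surface_threefold_tensor_curve (hHD : exists_isReal_hodgeModel) (hS : IsSmoothProjective 2 S) (hT : IsSmoothProjective 3 T)
    (hST : IsSmoothProjective 5 (S ⊗ T)) (hC : IsSmoothProjective 1 C) (hSTC : IsSmoothProjective d ((S ⊗ T) ⊗ C)) (hqS : (BettiUniverse.hodge hHD hS 1).hodgeNumber 1 0 = 0)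
    (hq : (BettiUniverse.hodge hHD hT 1).hodgeNumber 1 0 = 0) (hb3 : Module.finrank ℚ (bettiCohomology T 3) = 0)
    (h22 : Module.finrank ℚ (HodgeStructure.Hom (BettiUniverse.hodge hHD hS 2) (BettiUniverse.hodge hHD hT 2)) ≤
      Module.finrank ℚ ↥((BettiUniverse.hodge hHD hS 2).hodgeClasses 1) * Module.finrank ℚ ↥((BettiUniverse.hodge hHD hT 2).hodgeClasses 1)) :
    HodgeConjectureFor d ((S ⊗ T) ⊗ C) :=
  BettiUniverse.hodgeConjectureFor_tensor_curve_of_odd_vanishing hHD hST hC hSTC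
    (fun _ hk ↦ BettiUniverse.finrank_bettiCohomology_tensor_surface_threefold_eq_zero_of_odd hHD hS hT hqS hq hb3 hk)
    (BettiUniverse.hodgeConjectureFor_surface_tensor_threefold_of_q_zero_of_finrank_hom_le hHD hS hT hST hqS h22)

end HC

end Literature.AlgebraicGeometry.HodgeTheory

end
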